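import Literature.AnabelianGeometry.SemiGraphs.Arithmetic
import Literature.AnabelianGeometry.SemiGraphs.AmbientVocabDictionary
import Mathlib.CategoryTheory.Discrete.Basic
import HarnessLib

/-!
# [SemiAnbd] Def. 5.1 (i)(b) `Def51CondB` ("the semi-graph `𝔾` is locally finite") as a FACT-LIST row
# (F-1411): kernel closure census

Mochizuki, *Semi-graphs of anabelioids*, Publ. RIMS **42** (2006), §5, Def. 5.1 (i)(b) p. 62
[cite: MochizukiSemiAnbd2006, Def 5.1 (i)(b), p. 62].  abc-iut cell, D-0078 fact-proving wave, row
F-1411 of tranche 157 (`plan/F-TRANCHES.tsv`; seat abc-iut-f-157); PROOF-ONLY companion of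
`Arithmetic.lean` (abc-iut-L3-t3), where
`Def51CondB 𝓥 G : Prop := 𝓥.IsLocallyFinite G` (`:= ∀ v, Finite (𝓥.BrAt G v)`, finitely many branches
abut to each vertex) is condition (b) of the DEFINITION of a continuous action / an arithmetic
semi-graph of anabelioids (Def 5.1 (i), (ii)) — a HYPOTHESIS on the datum `𝔾`, not a theorem.  No
definition is introduced or restated (0 `def`s; the toy vocabulary below lives inside a proof).

WHAT IS RECORDED.

* `def51CondB_iff` — the row unfolds to the container's `IsLocallyFinite` (dictionary, `Iff.rfl`);
  `def51CondB_ofReal_iff` — at the REAL vocabulary `SemiAnbdVocab.ofReal R` it is t1's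
  `SemiGraph.IsLocallyFinite` of the underlying semi-graph (via `ofReal_isLocallyFinite_iff`).
* INSTANCE FORMS that hold: `def51CondB_of_finite_edge` / `def51CondB_of_isFinite` (a semi-graph with
  finitely many edges is locally finite: every edge has exactly two branches);
  `IsContinuousAction.def51CondB`, `ArithSemiGraph.def51CondB` (every continuous action, in particular
  the geometric component of every connected arithmetic semi-graph of anabelioids, satisfies (b) BY
  DEFINITION — this is how the cone consumes the row: as a field, never as a theorem about all `𝔾`).
* `SemiAnbdVocab.exists_vocab_not_isLocallyFinite` — the §§4–5 container `SemiAnbdVocab` admits a model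
  (on the discrete category with one object: one vertex, edge set `ℕ`, both branches of every edge
  abutting to the vertex; all class predicates trivial) with a connected object that is NOT locally
  finite; hence `not_forall_def51CondB`: the UNIVERSAL CLOSURE of F-1411 over the container is FALSE.

FACT-LIST reading: F-1411 = «definition clause / hypothesis predicate on `𝔾`; universal closure
SCHEMA-REFUTED (toy vocabulary); instance forms = structure fields (`IsContinuousActionAt.condB`)».
Classical; no side taken on [IUTchIII] Cor. 3.12; a FACT row is an assumption label; typed ≠ proved.
-/

namespace Literature.AnabelianGeometry.SemiGraphs

open _root_.CategoryTheory

universe u v w v₁ u₁ u₂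

section General

variable {Obj : Type u} [Category.{v} Obj] (𝓥 : SemiAnbdVocab.{u, v, w} Obj)

/-- Dictionary: Def 5.1 (i)(b) is the container's "locally finite" (finitely many branches abut to each
vertex, §1 p.13). [cite: MochizukiSemiAnbd2006, Def 5.1 (i)(b), p. 62] -/
theorem def51CondB_iff (G : Obj) : Def51CondB 𝓥 G ↔ 𝓥.IsLocallyFinite G := Iff.rfl

/-- Every edge of a semi-graph has finitely many (two) branches. [cite: MochizukiSemiAnbd2006, §1, p. 11] -/
theorem SemiAnbdVocab.finite_br {G : Obj} (e : 𝓥.Edge G) : Finite (𝓥.Br e) :=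
  Nat.finite_of_card_ne_zero (by rw [𝓥.natCard_br e]; decide)

/-- A semi-graph with finitely many edges is locally finite: the branches abutting to a vertex embed
in the (finite) set of all branches. [cite: MochizukiSemiAnbd2006, §1, p. 13] -/
theorem SemiAnbdVocab.isLocallyFinite_of_finite_edge (G : Obj) [Finite (𝓥.Edge G)] :
    𝓥.IsLocallyFinite G := by
  intro v
  haveI : ∀ e : 𝓥.Edge G, Finite (𝓥.Br e) := fun e => 𝓥.finite_br e
  unfold SemiAnbdVocab.BrAt
  infer_instance

/-- **Def 5.1 (i)(b) holds for every semi-graph with finitely many edges.**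
[cite: MochizukiSemiAnbd2006, Def 5.1 (i)(b), p. 62] -/
theorem def51CondB_of_finite_edge (G : Obj) [Finite (𝓥.Edge G)] : Def51CondB 𝓥 G :=
  𝓥.isLocallyFinite_of_finite_edge G

/-- **Def 5.1 (i)(b) holds for every finite semi-graph** (finitely many vertices and edges, §1 p.11).
[cite: MochizukiSemiAnbd2006, Def 5.1 (i)(b), p. 62] -/
theorem def51CondB_of_isFinite (G : Obj) (h : 𝓥.IsFinite G) : Def51CondB 𝓥 G := by
  haveI := h.2
  exact def51CondB_of_finite_edge 𝓥 G

/-- **Instance form consumed by the cone:** a continuous action (Def 5.1 (i)) satisfies (b) — by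
definition, for the witnessing open subgroup. [cite: MochizukiSemiAnbd2006, Def 5.1 (i)(b), p. 62] -/
theorem IsContinuousAction.def51CondB {G : Obj} {PA : ProfiniteGrp.{w}} {ρ : PA →* Aut G}
    (h : IsContinuousAction 𝓥 G PA ρ) : Def51CondB 𝓥 G := by
  obtain ⟨H, hH⟩ := h
  exact hH.condB

/-- **Instance form consumed by the cone:** the geometric component `𝔾` of every connected arithmetic
semi-graph of anabelioids `𝔊 = (𝔾, A, ρ_𝔾)` (Def 5.1 (ii)) is locally finite — condition (b) is part of
the continuity of `ρ_𝔾`. [cite: MochizukiSemiAnbd2006, Def 5.1 (ii), p. 62] -/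
theorem ArithSemiGraph.def51CondB (𝔊 : ArithSemiGraph 𝓥) : Def51CondB 𝓥 𝔊.G :=
  IsContinuousAction.def51CondB 𝓥 𝔊.continuous

/-- A vertex receiving infinitely many branches (an injection `ℕ ↪ BrAt G v`) violates local
finiteness. [cite: MochizukiSemiAnbd2006, §1, p. 13] -/
theorem SemiAnbdVocab.not_isLocallyFinite_of_injective (G : Obj) (v : 𝓥.Vert G)
    (f : ℕ → 𝓥.BrAt G v) (hf : Function.Injective f) : ¬ 𝓥.IsLocallyFinite G := by
  intro h
  haveI := h v
  haveI : Infinite (𝓥.BrAt G v) := Infinite.of_injective f hf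
  exact not_finite (𝓥.BrAt G v)

/-- A semi-graph with exactly one vertex, to which every edge abuts, is connected.
[cite: MochizukiSemiAnbd2006, §2, p. 22] -/
theorem SemiAnbdVocab.isConnected_of_unique_vertex (G : Obj) (v₀ : 𝓥.Vert G)
    (hV : ∀ v : 𝓥.Vert G, v = v₀) (hE : ∀ e : 𝓥.Edge G, ∃ b : 𝓥.Br e, 𝓥.abut b = some v₀) :
    𝓥.IsConnected G := by
  have key : ∀ x : 𝓥.Vert G ⊕ 𝓥.Edge G, Relation.EqvGen (𝓥.Incident G) x (Sum.inl v₀) := by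
    rintro (v | e)
    · rw [hV v]
      exact Relation.EqvGen.refl _
    · exact Relation.EqvGen.rel _ _ (hE e)
  exact ⟨⟨Sum.inl v₀⟩, fun x y => (key x).trans _ _ _ ((key y).symm _ _)⟩

end General

/-! ### The real vocabulary -/

section Real

open SgAQuot SgAQuot.SgA

/-- **At the real vocabulary** `SemiAnbdVocab.ofReal R` (totally aloof, verticially slim semi-graphs of
anabelioids and locally open morphisms), Def 5.1 (i)(b) is t1's `SemiGraph.IsLocallyFinite` of the
underlying semi-graph (finitely many edges abut to each vertex). [cite: MochizukiSemiAnbd2006, Def 5.1 (i)(b), p. 62] -/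
theorem def51CondB_ofReal_iff (R : SgA.BridgeResidual.{v₁, u₁, u₂}) (G : SgA.{v₁, u₁, u₂}) :
    Def51CondB (SemiAnbdVocab.ofReal R) G ↔ G.toSgA.graph.IsLocallyFinite :=
  SemiAnbdVocab.ofReal_isLocallyFinite_iff R G

end Real

/-! ### A model of the container with a non-locally-finite connected object -/

section Toy

/-- **The §§4–5 container has a model with a connected, "coherent" object that is NOT locally finite**:
on the discrete category with one object take the underlying semi-graph with one vertex, edge set `ℕ`,
two branches per edge both abutting to the vertex, all localizations the object itself, all class
predicates trivially true, `Out(π̂₁(G_v))` trivial (a TOY vocabulary: the container's fields are data,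
definitional predicates and formal laws, all satisfied here; it is not the real vocabulary
`SemiAnbdVocab.ofReal`). [cite: MochizukiSemiAnbd2006, Def 5.1 (i)(b), p. 62] -/
theorem SemiAnbdVocab.exists_vocab_not_isLocallyFinite :
    ∃ 𝓥 : SemiAnbdVocab.{0, 0, 0} (Discrete PUnit.{1}), ∀ X : Discrete PUnit.{1},
      𝓥.IsConnected X ∧ 𝓥.IsCoherent X ∧ ¬ 𝓥.IsLocallyFinite X := by
  refine ⟨{ Vert := fun _ => PUnit
            Edge := fun _ => ℕ
            Br := fun _ => Bool
            abut := fun _ => some PUnit.unit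
            natCard_br := fun _ => by simp
            mapV := fun _ x => x
            mapE := fun _ e => e
            mapBr := fun _ _ b => b
            mapBr_bijective := fun _ _ => Function.bijective_id
            abut_mapBr := fun _ _ _ _ h => h
            mapV_id := fun _ _ => rfl
            mapV_comp := fun _ _ _ => rfl
            mapE_id := fun _ _ => rfl
            mapE_comp := fun _ _ _ => rfl
            locV := fun G _ => G
            locE := fun G _ => G
            locB := fun G _ _ => G
            ιV := fun G _ => 𝟙 G
            ιE := fun G _ => 𝟙 G
            ιB := fun G _ _ => 𝟙 G
            βV := fun G _ _ _ _ => 𝟙 G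
            βE := fun G _ _ => 𝟙 G
            βV_ι := fun _ _ _ _ _ => Category.comp_id _
            βE_ι := fun _ _ _ => Category.comp_id _
            centerV := fun _ x => x
            mapV_centerV := fun _ _ => rfl
            centerE := fun _ e => e
            mapE_centerE := fun _ _ => rfl
            locMapV := fun f _ _ _ => f
            locMapE := fun f _ _ _ => f
            locMapV_ι := fun _ _ _ _ => by simp
            locMapE_ι := fun _ _ _ _ => by simp
            locMapV_id := fun _ _ _ => rfl
            locMapV_comp := fun _ _ _ _ _ _ _ _ => rfl
            locMapE_id := fun _ _ _ => rfl
            locMapE_comp := fun _ _ _ _ _ _ _ _ => rfl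
            vertDegree := fun _ _ => 1
            OutVert := fun _ _ => ProfiniteGrp.of PUnit.{1}
            outRep := fun _ _ _ => 1
            IsOfInjectiveType := fun _ => True
            IsQuasiCoherent := fun _ => True
            IsCoherent := fun _ => True
            isQuasiCoherent_of_isCoherent := fun _ _ => trivial
            IsTotallyElevated := fun _ => True
            IsTotallyUnivSubcoverticial := fun _ => True
            IsTotallyEstranged := fun _ => True
            IsLocallyTrivial := fun _ => True
            IsLocallyFiniteEtale := fun _ => True
            IsFiniteEtale := fun _ => True
            IsTempered := fun _ => True
            isLocallyFiniteEtale_of_isLocallyTrivial := fun _ _ => trivial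
            isLocallyFiniteEtale_of_isFiniteEtale := fun _ _ => trivial
            isTempered_of_isFiniteEtale := fun _ _ => trivial
            isLocallyFiniteEtale_of_isTempered := fun _ _ => trivial
            isLocallyTrivial_id := fun _ => trivial
            isLocallyFiniteEtale_comp := fun _ _ _ _ => trivial
            isLocallyTrivial_ιV := fun _ _ => trivial
            isLocallyTrivial_ιE := fun _ _ => trivial
            isLocallyTrivial_βV := fun _ _ _ _ _ => trivial
            isLocallyTrivial_βE := fun _ _ _ => trivial
            isLocallyFiniteEtale_locMapV := fun _ _ _ _ _ => trivial
            isLocallyFiniteEtale_locMapE := fun _ _ _ _ _ => trivial }, fun X => ⟨?_, trivial, ?_⟩⟩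
  · exact SemiAnbdVocab.isConnected_of_unique_vertex _ X PUnit.unit (fun _ => rfl)
      (fun _ => ⟨true, rfl⟩)
  · exact SemiAnbdVocab.not_isLocallyFinite_of_injective _ X PUnit.unit
      (fun n => ⟨⟨n, true⟩, rfl⟩) (fun a b hab => by
        simpa using congrArg (fun x : {x : Σ _ : ℕ, Bool // _} => x.1.1) hab)

/-- **F-1411 is a definition clause: its universal closure over the §§4–5 container is FALSE** (witness:
the toy vocabulary of `SemiAnbdVocab.exists_vocab_not_isLocallyFinite`).
[cite: MochizukiSemiAnbd2006, Def 5.1 (i)(b), p. 62] -/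
theorem not_forall_def51CondB :
    ¬ ∀ (Obj : Type) [Category.{0} Obj] (𝓥 : SemiAnbdVocab.{0, 0, 0} Obj) (G : Obj),
      Def51CondB 𝓥 G := by
  intro h
  obtain ⟨𝓥, h𝓥⟩ := SemiAnbdVocab.exists_vocab_not_isLocallyFinite
  exact (h𝓥 ⟨PUnit.unit⟩).2.2 (h _ 𝓥 _)

/-- Summary: Def 5.1 (i)(b) takes both truth values over the container — false at the toy object above,
true at any object with finitely many edges, e.g. the geometric component of any arithmetic semi-graph
of anabelioids (by definition). [cite: MochizukiSemiAnbd2006, Def 5.1 (i)(b), p. 62] -/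
theorem def51CondB_both_ways :
    (∃ (𝓥 : SemiAnbdVocab.{0, 0, 0} (Discrete PUnit.{1})) (G : Discrete PUnit.{1}),
        𝓥.IsConnected G ∧ ¬ Def51CondB 𝓥 G) ∧
      ∀ (Obj : Type u) [Category.{v} Obj] (𝓥 : SemiAnbdVocab.{u, v, w} Obj) (𝔊 : ArithSemiGraph 𝓥),
        Def51CondB 𝓥 𝔊.G := by
  refine ⟨?_, fun Obj _ 𝓥 𝔊 => ArithSemiGraph.def51CondB 𝓥 𝔊⟩
  obtain ⟨𝓥, h𝓥⟩ := SemiAnbdVocab.exists_vocab_not_isLocallyFinite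
  exact ⟨𝓥, ⟨PUnit.unit⟩, (h𝓥 _).1, (h𝓥 _).2.2⟩

end Toy

end Literature.AnabelianGeometry.SemiGraphs
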